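import Literature.NumberTheory.EllipticCurves.ModularCurve
import Literature.NumberTheory.EllipticCurves.QuadraticTwist
import Literature.NumberTheory.EllipticCurves.Isogeny
import Literature.NumberTheory.EllipticCurves.GlobalMinimalModel
import Literature.NumberTheory.DiophantineGeometry.Conductor
import HarnessLib
import HarnessLib.Audit.Tags

/-!
# Candidate E-imc-2: ramified-twist INVARIANCE of `ord_p(c_E)` (`RamifiedTwistManinInvariance p`)
# — cell `bsd-f2-manin` (D-0131 (3) frontier: the Manin constant at additive primes). `@[conjecture]`
# leaf (NOTHING asserted; definitions only; proved edges in `RamifiedTwistEdges.lean`).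

HONEST FRAMING. LENS = Iwasawa-main-conjecture / Λ-adic integrality read as RAMIFIED-QUADRATIC-TWIST
laws at the additive prime (planner-of-record `bsd-f2-manin-imc`, HOME
`run/shared/lean/pub/bsd-f2-manin/MEMO-imc.md` §§1–5 (sha16 7c7fd3ff00b6a3f6), Props VERBATIM from
HOME/imc/Sketch-imc.lean (namespace `BsdF2ManinImc`, farm rc 0) with its two abbreviations inlined:
`pStar p = (((-1)^(p/2) · p : ℤ) : ℚ)` (`p* = (−1)^{(p−1)/2} p` for odd `p`, the spelling of the tree's
`ModularParametrizationData.deg_mul_sq_mul_sq_eq_of_quadraticTwist_pStar`) and `IsLatticeOptimal D`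
= the lattice clause `Λ_W = c·Λ_f`. «Ramified twist pair at `p`»: `W`, `W′` globally minimal models
of the `X₀(N)`-optimal curves of a class `𝒜` and of `𝒜 ⊗ χ_{p*}` (data `D`, `D′` at the CONDUCTOR
levels with the lattice clauses — refuter-1 traps T1/T2/T3 on BOTH curves), both additive at `p`
(`p² ∣ N`), SAME conductor (automatic for `p ≥ 5` potentially good; a restriction at `p = 3`),
`W′ ~ W ⊗ χ_{p*}`. Lens dictionary and why this is the IMC reading: memo §1 (no Hida family through
an `a_p = 0` newform; the family is the twist orbit, `R_ψ` plays `U_p`, the «divisibility» is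
Edixhoven's index law `[s⁻¹Λ_f : Λ_{f⊗ψ}] ∈ {1, p}`). NOT in print (memo §7; refuter-2 pre-placement
B4/B5): printed twist transports of the Manin `p`-part need the partner SEMISTABLE at `p` (Stevens
1989 §5; tree `ManinConstantQuadraticTwist*`) or settle only the potentially supersingular case
(Edixhoven 1991 §4); Watkins 2002 §2.1 / Delaunay 2003 give the degree identity «if we assume the
Manin constants are the same» (tree PROVED `…deg_mul_sq_mul_sq_eq_of_quadraticTwist_pStar`:
`D′.deg·D.c²·u² = p·D.deg·D′.c²`, silent on optimality and on `ord_p c`). Data: memo §5 and the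
in-seat PAIRWISE TWIST CENSUS v0 (HOME/imc/TWISTCENSUS-v0-N1e5-*, N < 10⁵, 578 278 rows) which
KILLED the v1 forms of IMC-D / IMC-A without `E[p]` irreducible (HOME/CANDIDATES.md §F F-imc-1/3:
50a1 ⊗ χ₅ ≅ 50b3, 5-isogenous to the optimal 50b1). Refuter verdicts: REF1 **SURVIVES** 2026-08-27T14:02Z
(HOME/REFUTER-ref1.md §R1.4: conjecture strictly weaker than Manin's; MC ⇒ row re-proved by two
engines; data-invisible; crux probes BC7 CLEAN); REF2 pending at filing.

THIS ROW (E-imc-2, memo §3 IMC-T; Manin-facing, symmetric, CM allowed): for a ramified twist pair of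
optimal curves at the odd prime `p`, `ord_p(c(opt 𝒜 ⊗ χ_{p*})) = ord_p(c(opt 𝒜))`. No in-range teeth
(`c ≡ 1`, refuter-1 T4); its payoff is the EDGE (memo §3): this ∧ Edixhoven 1991 Thm. 3 (tree fact
`edixhoven_not_dvd_maninConstant_of_kodairaSymbol_ne`) ∧ routine P1/P2/P3 ⟹ `p ∤ c₀` for every
lattice-optimal datum at every `p ≥ 11` with `p² ∣ N` = AKR crux 20483's `stub_memberManinUnit_ordinary`
— a LINE on 20483 (crux idea filed there by the planner), not a rival (20483 is Manin's `p`-part itself).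
SHARPENED ANSWER to the search question (memo §0): no local invariant ALONE controls `ord_p(c_E)`; it is
predicted constant on ramified-twist orbits, the local type controlling only the ORIENTATION.
-/

noncomputable section

open scoped MatrixGroups ModularForm

open CongruenceSubgroup WeierstrassCurve
  Literature.NumberTheory.EllipticCurves Literature.NumberTheory.EllipticCurves.ModularForms

namespace Summit.BirchSwinnertonDyer.Rank1Residual.ManinAdditive

/-- **Candidate E-imc-2 `RamifiedTwistManinInvariance p` (cell bsd-f2-manin; a LAW, NOT in print,
nothing asserted):** for an odd prime `p`, a globally minimal `W` with `p² ∣ N(W)` carrying a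
lattice-optimal datum `D` at the conductor level (`W` = the optimal curve of its class, `D.c = ±c_E`)
and a globally minimal `W′` of the SAME conductor, isogenous to `W ⊗ χ_{p*}`, carrying a
lattice-optimal datum `D′` (the optimal curve of the twisted class): `ord_p(D′.c) = ord_p(D.c)`.
Symmetric in the pair; no orientation. Weakening of Manin's conjecture (edge in `RamifiedTwistEdges.lean`).
[cite: EdixhovenManin1991, §4 (shape only: the two-case index analysis Λ̃ = δ^±1 Λ for the twisted newform lattice; the invariance law with BOTH members additive is NOT in print — cell bsd-f2-manin MEMO-imc.md §3 IMC-T)] -/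
@[conjecture] def RamifiedTwistManinInvariance (p : ℕ) : Prop :=
  ∀ (W W' : WeierstrassCurve ℚ) [W.IsElliptic] [W.IsGloballyMinimal] [W'.IsElliptic]
    [W'.IsGloballyMinimal] [NeZero (W.conductorNorm ℤ)] [NeZero (W'.conductorNorm ℤ)]
    (D : ModularParametrizationData W (W.conductorNorm ℤ))
    (D' : ModularParametrizationData W' (W'.conductorNorm ℤ)),
    p.Prime → p ≠ 2 →
    (∀ z ∈ D.L.lattice, ∃ w ∈ periodLattice D.f, z = D.c * w) →
    (∀ z ∈ D'.L.lattice, ∃ w ∈ periodLattice D'.f, z = D'.c * w) →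
    p ^ 2 ∣ W.conductorNorm ℤ → W'.conductorNorm ℤ = W.conductorNorm ℤ →
    IsIsogenous (W.quadraticTwist ((((-1 : ℤ) ^ (p / 2) * p : ℤ) : ℚ))) W' →
    padicValInt p D'.maninConstant = padicValInt p D.maninConstant

end Summit.BirchSwinnertonDyer.Rank1Residual.ManinAdditive

end
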